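/-
Copyright (c) 2026. All rights reserved.
Released under Apache 2.0 license as described in the file LICENSE.
Authors: abc-iut cell, wave-6 cone prover seat abc-iut-w6-d025 (gen 5; L4-lead m151 (4) row «TWO-SIDED-SUM», file 2/2), over
this seat's `LogFrobeniusSettingSum.lean`, abc-iut-L4-t3's add-ons (`MonoTelecoreCoherence`, `IotaAnMono`, `EtaNatural`),
abc-iut-f-101's pinned Cor 5.10 (iv)(b)(c) sufficiency and genuine open-augmentation instances, and this lineage's
`archGenuineMonoAnChart`.
-/
import Literature.AnabelianGeometry.AbsoluteAnabelian.LogFrobeniusSettingSum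
import Literature.AnabelianGeometry.AbsoluteAnabelian.LogFrobeniusIotaEtaSquareGenuineOpen
import Literature.AnabelianGeometry.AbsoluteAnabelian.LogFrobeniusArchGenuineIotaAnMono
import HarnessLib

/-!
# [AbsTopIII] Cor 5.10 (iv)(b)(c) for the SUM of two settings: the coherence add-on from the factors SEPARATELY, the pinned
# telecore/contact clauses, the `η⊢`-square — and genuine instances (two residue characteristics; nonarchimedean ⊔ archimedean)

S. Mochizuki, *Topics in absolute anabelian geometry III*, J. Math. Sci. Univ. Tokyo 22 (2015) [MochizukiAbsTopIII2015];
manuscript `paper:url-5493eb38cbb7`: Prop 5.8 (vii) pp. 141–142 ("`w ∈ W_non` (respectively, `w ∈ W_arc`)"), Cor 5.10 (iv)(b)(c)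
pp. 147–148 (the mono-analytic telecore `𝔗_{An⊢}`, the contact structure `ℋ_{An⊢}`, "isomorphisms `η⊢_{v,ν}`" for EACH
`v ∈ V(F_mod)`), Def 3.5 (ii) p. 75 (one family of homotopies).

## What this file builds (row «TWO-SIDED-SUM», file 2/2; PROOFS + the three small instance definitions)

Over `L₁.sum L₂` (file 1: global categories the products, each place its own factor's local row):

* ★ `sumMonoTelecoreCoherence K₁ K₂ : (L₁.sum L₂).MonoTelecoreCoherence (sumMonoAnalyticizationHomotopies M₁ M₂)` — from
  coherence data of the factors SEPARATELY, each over ITS OWN index set: at `inl v`, «`ψ` over `ℰ⊢`» is `hψ₁ × 𝟙`, the printed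
  `η⊢_{v,ν}` is `η₁,v × (unit of κ₂)⁻¹` on the carried object, and the coherence «`η⊢` over `ℰ⊢`» holds componentwise;
* ★ `sum_cor510MonoTelecorePinned` — the PINNED Cor 5.10 (iv)(b)(c) for the sum (abc-iut-f-101's sufficiency theorem
  `MonoTelecoreCoherence.cor510MonoTelecorePinned` BY NAME);
* `sum_iotaPre_app_inl/_inr`, `sum_gammaZeroApp_inl/_inr`, `sum_gammaOneApp_inl/_inr` (component computations) and ★
  `etaNatural_sum : K₁.EtaNatural I₁ → K₂.EtaNatural I₂ → (sumMonoTelecoreCoherence K₁ K₂).EtaNatural (sumIotaData I₁ I₂)`;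
* GENUINE INSTANCES: ★ `twoPrimeOpen p ℓ V₁ V₂ := (genuineOpen p V₁).sum (genuineOpen ℓ V₂)` — nonarchimedean places of TWO
  residue characteristics in ONE setting — with `twoPrimeOpen_monoTelecoreCoherence`, `twoPrimeOpen_cor510MonoTelecorePinned`,
  `twoPrimeOpen_etaNatural` ALL hypothesis-free from abc-iut-f-101 / abc-iut-L4-t3's one-prime theorems
  (`monoTelecoreCoherence_open`, `etaNatural_genuineOpen`); and `genuineTwoSidedSum p 𝔄 V₁ V₂ :=
  (genuineOpen p V₁).sum (archGenuineMonoAnChart 𝔄 V₂ (fun _ => true))` — genuine nonarchimedean AND archimedean rows in ONE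
  setting with NO filler slot — with its mono-analyticization homotopies, Cor 5.10 (iv)(a), the `ι^{An⊢⊞}` add-on, and
  `genuineTwoSidedSum_monoTelecoreCoherence_of (K_arc)`: its coherence the moment an archimedean coherence datum exists
  (the arc `η⊢` content is in tree, abc-iut-w5-d038 `HolTFPair.etaTilde`/`etaTimes`; its packaging as a coherence datum is the
  L4-lead's pending interface ruling m151 (3) — stated here with `K_arc` a BINDER, honestly).

MODEL-LEVEL; honest limits (P1), (P3) of `LogFrobeniusSettingSum.lean`; nothing here bears on [IUTchIII] Cor. 3.12; OUR kernel
check, no side taken; instantiated ≠ endorsed; typed ≠ proved elsewhere.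
-/

set_option autoImplicit false

noncomputable section

open CategoryTheory

universe u

namespace Literature.AnabelianGeometry.AbsoluteAnabelian

namespace LogFrobeniusSetting

variable {V₁ V₂ : Type u} {isArc₁ : V₁ → Bool} {isArc₂ : V₂ → Bool}
  {L₁ : LogFrobeniusSetting V₁ isArc₁} {L₂ : LogFrobeniusSetting V₂ isArc₂}
  {M₁ : L₁.MonoAnalyticizationHomotopies} {M₂ : L₂.MonoAnalyticizationHomotopies}

/-! ## §1. The coherence add-on of the sum from the factors' coherence, each over its own index set -/

section Carried

variable {Vmod : Type u} {isArc : Vmod → Bool} (L : LogFrobeniusSetting Vmod isArc)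

/-- The `η⊢`-leg on the CARRIED global object of the other factor: along `□ → 𝒩⊞ → 𝒩 → ℰ• → ℰ⊢ ⥲ An⊢ → 𝒩⊢⊞` it is read
through `proj ⋙ monoAn ⋙ κ ⋙ κ⁻¹`, along `□ → 𝒩⊞ → 𝒩⊢⊞` through `proj ⋙ monoAn`; the canonical isomorphism between the two
is the inverse unit of the equivalence `κ_{An⊢}`. [cite: MochizukiAbsTopIII2015, Cor 5.10 (iv)(c) p. 148] -/
def carriedEta :
    (𝟭 L.X ⋙ 𝟭 L.X ⋙ L.proj ⋙ L.monoAn ⋙ L.κAnMono.functor ⋙ L.κAnMono.inverse) ≅ (𝟭 L.X ⋙ (L.proj ⋙ L.monoAn)) :=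
  NatIso.ofComponents (fun y => (L.κAnMono.unitIso.app (L.monoAn.obj (L.proj.obj y))).symm)
    (fun f => L.κAnMono.unitIso.inv.naturality (L.monoAn.map (L.proj.map f)))

/-- Its components are the inverse unit. [cite: MochizukiAbsTopIII2015, Cor 5.10 (iv)(c) p. 148] -/
@[simp] theorem carriedEta_hom_app (y : L.X) :
    L.carriedEta.hom.app y = L.κAnMono.unitIso.inv.app (L.monoAn.obj (L.proj.obj y)) := rfl

/-- … and the unit. [cite: MochizukiAbsTopIII2015, Cor 5.10 (iv)(c) p. 148] -/
@[simp] theorem carriedEta_inv_app (y : L.X) :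
    L.carriedEta.inv.app y = L.κAnMono.unitIso.hom.app (L.monoAn.obj (L.proj.obj y)) := rfl

end Carried

/-- The printed `η⊢_{v,ν}` of the sum at `inl v`: `η₁,v,ν` on the first factor and `carriedEta` on the carried global object
of the second factor; symmetric at `inr v`. [cite: MochizukiAbsTopIII2015, Cor 5.10 (iv)(c) p. 148] -/
def sumEta (K₁ : L₁.MonoTelecoreCoherence M₁) (K₂ : L₂.MonoTelecoreCoherence M₂) :
    ∀ (v : V₁ ⊕ V₂) (ν : LogVertex (Sum.elim isArc₁ isArc₂ v)) (hν : ν.IsCross),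
      (L₁.sum L₂).lam v ν ⋙ (L₁.sum L₂).forget v ⋙ (L₁.sum L₂).toE v ⋙ (L₁.sum L₂).monoAn ⋙
          (L₁.sum L₂).κAnMono.functor ⋙ (L₁.sum L₂).ψAnMono v ⟨ν, hν⟩ ≅
        (L₁.sum L₂).lam v ν ⋙ (L₁.sum L₂).monoNplus v
  | .inl v, ν, hν => NatIso.prod (K₁.eta v ν hν) L₂.carriedEta
  | .inr v, ν, hν => NatIso.prod L₁.carriedEta (K₂.eta v ν hν)

/-- ★ **The coherence add-on of the SUM from coherence data of the factors SEPARATELY** (each over its own index set): at each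
place the own factor's «`ψ` over `ℰ⊢`», printed `η⊢_{v,ν}` and coherence, and identities / the unit of `κ` on the carried
object. [cite: MochizukiAbsTopIII2015, Cor 5.10 (iv)(c) p. 148] -/
def sumMonoTelecoreCoherence (K₁ : L₁.MonoTelecoreCoherence M₁) (K₂ : L₂.MonoTelecoreCoherence M₂) :
    (L₁.sum L₂).MonoTelecoreCoherence (sumMonoAnalyticizationHomotopies M₁ M₂) where
  psiOver := sumψOverIso K₁.psiOver K₂.psiOver
  eta := sumEta K₁ K₂
  eta_over
    | .inl v, ν, hν, y => by
      refine Prod.ext (K₁.eta_over v ν hν y.1) ?_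
      change L₂.carriedEta.hom.app y.2 ≫ (𝟙 _ ≫ 𝟙 _) ≫ (L₂.proj ⋙ L₂.monoAn).rightUnitor.hom.app y.2 =
        𝟙 _ ≫ L₂.κAnMono.unitIso.inv.app (L₂.monoAn.obj (L₂.proj.obj y.2))
      simp only [carriedEta_hom_app, Category.id_comp, Functor.rightUnitor_hom_app]
      exact Category.comp_id _
    | .inr v, ν, hν, y => by
      refine Prod.ext ?_ (K₂.eta_over v ν hν y.2)
      change L₁.carriedEta.hom.app y.1 ≫ (𝟙 _ ≫ 𝟙 _) ≫ (L₁.proj ⋙ L₁.monoAn).rightUnitor.hom.app y.1 =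
        𝟙 _ ≫ L₁.κAnMono.unitIso.inv.app (L₁.monoAn.obj (L₁.proj.obj y.1))
      simp only [carriedEta_hom_app, Category.id_comp, Functor.rightUnitor_hom_app]
      exact Category.comp_id _

/-- ★ **PINNED Cor 5.10 (iv)(b)(c) for the sum** (`V₁ ⊕ V₂ ≠ ∅`): abc-iut-f-101's sufficiency theorem fed BY NAME with the sum's
coherence add-on. [cite: MochizukiAbsTopIII2015, Cor 5.10 (iv)(b)(c) pp. 147–148] -/
theorem sum_cor510MonoTelecorePinned [Nonempty (V₁ ⊕ V₂)] (K₁ : L₁.MonoTelecoreCoherence M₁)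
    (K₂ : L₂.MonoTelecoreCoherence M₂) : (L₁.sum L₂).Cor510MonoTelecorePinned :=
  (sumMonoTelecoreCoherence K₁ K₂).cor510MonoTelecorePinned


/-! ## §2. The `η⊢`-square is inherited by the sum -/

section EtaSquare

variable (L₁ L₂)

/-- At a pre-log source the canonical `Λ ⟶ 𝟭` is an `eqToHom`. [cite: MochizukiAbsTopIII2015, Def 5.4 (vii) p. 128] -/
theorem twistToId_eq_eqToHom {Vmod : Type u} {isArc : Vmod → Bool} (L : LogFrobeniusSetting Vmod isArc) (c : Bool)
    (hc : c = false) : L.twistToId c = eqToHom (by rw [hc]; rfl) := by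
  subst hc
  rfl

/-- `ι⊞` of a factor = cast ≫ untwisted `ι⊞`. [cite: MochizukiAbsTopIII2015, Def 5.4 (vii) p. 128] -/
theorem iota_eq_eqToHom_comp_iotaPre' {Vmod : Type u} {isArc : Vmod → Bool} (L : LogFrobeniusSetting Vmod isArc) (v : Vmod)
    {ν₁ ν₂ : LogVertex (isArc v)} (ε : LogEdge (isArc v) ν₁ ν₂) (h₁ : ν₁.isPostLog = false) :
    L.iota v ε = eqToHom (L.twist_comp_lam_eq v ν₁ h₁) ≫ L.iotaPre v ε h₁ := by
  rw [iotaPre, eqToHom_trans_assoc, eqToHom_refl, Category.id_comp]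

/-- Product of two cast-prefixed transformations. [folklore] -/
private theorem natTransProd_eqToHom_comp {A B C D : Type*} [Category A] [Category B] [Category C] [Category D]
    {F F' G : A ⥤ B} {H H' K : C ⥤ D} (hF : F = F') (hH : H = H') (α : F' ⟶ G) (β : H' ⟶ K) :
    NatTrans.prod (eqToHom hF ≫ α) (eqToHom hH ≫ β) = eqToHom (by rw [hF, hH]) ≫ NatTrans.prod α β := by
  subst hF hH
  simp only [eqToHom_refl, Category.id_comp]

/-- Two casts followed by a morphism are one cast followed by it. [folklore] -/
private theorem eqToHom_comp_eqToHom_comp {C : Type*} [Category C] {X Y Z W : C} (p : X = Y) (q : Y = Z) (f : Z ⟶ W) :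
    eqToHom p ≫ eqToHom q ≫ f = eqToHom (p.trans q) ≫ f := by
  cases p; cases q; simp

/-- **The untwisted `ι⊞` of the sum at `inl v`**: `iotaPre₁ × 𝟙`. [cite: MochizukiAbsTopIII2015, Def 5.4 (vii) p. 128] -/
theorem sum_iotaPre_inl (v : V₁) {ν₁ ν₂ : LogVertex (isArc₁ v)} (ε : LogEdge (isArc₁ v) ν₁ ν₂)
    (h₁ : ν₁.isPostLog = false) :
    (L₁.sum L₂).iotaPre (.inl v) ε h₁ = NatTrans.prod (L₁.iotaPre v ε h₁) (𝟙 (𝟭 L₂.X)) := by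
  refine iotaPre_eq_of_iota_eq (L₁.sum L₂) (Sum.inl v) ε h₁ _ ?_
  rw [sum_iota_inl, L₁.iota_eq_eqToHom_comp_iotaPre' v ε h₁, L₂.twistToId_eq_eqToHom _ h₁,
    ← Category.comp_id (eqToHom (_ : frobeniusTwist L₂.log ν₁.isPostLog = 𝟭 L₂.X)), natTransProd_eqToHom_comp]
  exact eqToHom_comp_eqToHom_comp _ _ _

/-- **The untwisted `ι⊞` of the sum at `inr v`**: `𝟙 × iotaPre₂`. [cite: MochizukiAbsTopIII2015, Def 5.4 (vii) p. 128] -/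
theorem sum_iotaPre_inr (v : V₂) {ν₁ ν₂ : LogVertex (isArc₂ v)} (ε : LogEdge (isArc₂ v) ν₁ ν₂)
    (h₁ : ν₁.isPostLog = false) :
    (L₁.sum L₂).iotaPre (.inr v) ε h₁ = NatTrans.prod (𝟙 (𝟭 L₁.X)) (L₂.iotaPre v ε h₁) := by
  refine iotaPre_eq_of_iota_eq (L₁.sum L₂) (Sum.inr v) ε h₁ _ ?_
  rw [sum_iota_inr, L₂.iota_eq_eqToHom_comp_iotaPre' v ε h₁, L₁.twistToId_eq_eqToHom _ h₁,
    ← Category.comp_id (eqToHom (_ : frobeniusTwist L₁.log ν₁.isPostLog = 𝟭 L₁.X)), natTransProd_eqToHom_comp]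
  exact eqToHom_comp_eqToHom_comp _ _ _

/-- `γ⁰` of the sum at `inl v`, first component = `γ⁰` of the first factor. [cite: MochizukiAbsTopIII2015, Cor 5.10 (iv)(c) p. 148] -/
theorem sum_gammaZeroApp_inl_fst (v : V₁) {ν₁ ν₂ : LogVertex (isArc₁ v)} (ε : LogEdgeTS (isArc₁ v) ν₁ ν₂)
    (hε : ε.InCore) (y : (L₁.sum L₂).X) :
    ((L₁.sum L₂).gammaZeroApp (.inl v) ε hε y).1 = L₁.gammaZeroApp v ε hε y.1 := by
  simp only [gammaZeroApp, iotaCore, sum_iotaPre_inl]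
  rfl

/-- … second component = an identity (the carried object does not move along `ι⊞` of the other factor).
[cite: MochizukiAbsTopIII2015, Cor 5.10 (iv)(c) p. 148] -/
theorem sum_gammaZeroApp_inl_snd (v : V₁) {ν₁ ν₂ : LogVertex (isArc₁ v)} (ε : LogEdgeTS (isArc₁ v) ν₁ ν₂)
    (hε : ε.InCore) (y : (L₁.sum L₂).X) :
    ((L₁.sum L₂).gammaZeroApp (.inl v) ε hε y).2 = 𝟙 ((L₂.proj ⋙ L₂.monoAn).obj y.2) := by
  simp only [gammaZeroApp, iotaCore, sum_iotaPre_inl]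
  exact (L₂.proj ⋙ L₂.monoAn).map_id _

/-- `γ⁰` of the sum at `inr v`, components. [cite: MochizukiAbsTopIII2015, Cor 5.10 (iv)(c) p. 148] -/
theorem sum_gammaZeroApp_inr_snd (v : V₂) {ν₁ ν₂ : LogVertex (isArc₂ v)} (ε : LogEdgeTS (isArc₂ v) ν₁ ν₂)
    (hε : ε.InCore) (y : (L₁.sum L₂).X) :
    ((L₁.sum L₂).gammaZeroApp (.inr v) ε hε y).2 = L₂.gammaZeroApp v ε hε y.2 := by
  simp only [gammaZeroApp, iotaCore, sum_iotaPre_inr]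
  rfl

/-- … first component = an identity. [cite: MochizukiAbsTopIII2015, Cor 5.10 (iv)(c) p. 148] -/
theorem sum_gammaZeroApp_inr_fst (v : V₂) {ν₁ ν₂ : LogVertex (isArc₂ v)} (ε : LogEdgeTS (isArc₂ v) ν₁ ν₂)
    (hε : ε.InCore) (y : (L₁.sum L₂).X) :
    ((L₁.sum L₂).gammaZeroApp (.inr v) ε hε y).1 = 𝟙 ((L₁.proj ⋙ L₁.monoAn).obj y.1) := by
  simp only [gammaZeroApp, iotaCore, sum_iotaPre_inr]
  exact (L₁.proj ⋙ L₁.monoAn).map_id _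

variable {L₁ L₂}
variable {K₁ : L₁.MonoTelecoreCoherence M₁} {K₂ : L₂.MonoTelecoreCoherence M₂}
  (I₁ : K₁.IotaData) (I₂ : K₂.IotaData)

/-- The `ι^{An⊢⊞}`-data of the sum's coherence add-on: `sumIotaAnMono`. [cite: MochizukiAbsTopIII2015, Prop 5.8 (vii) p. 142] -/
def sumIotaData : (sumMonoTelecoreCoherence K₁ K₂).IotaData := sumIotaAnMono I₁ I₂

/-- `γ¹` of the sum at `inl v`, first component = `γ¹` of the first factor. [cite: MochizukiAbsTopIII2015, Cor 5.10 (iv)(c) p. 148] -/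
theorem sum_gammaOneApp_inl_fst (v : V₁) {ν₁ ν₂ : LogVertex (isArc₁ v)} (ε : LogEdgeTS (isArc₁ v) ν₁ ν₂)
    (hε : ε.InCore) (y : (L₁.sum L₂).X) :
    ((sumIotaData I₁ I₂).gammaOneApp (.inl v) ε hε y).1 = I₁.gammaOneApp v ε hε y.1 := by
  simp only [IotaAnMono.gammaOneApp, iotaCore, sum_iotaPre_inl, sumIotaData, sumIotaAnMono_ι_inl]
  rfl

/-- … second component = an identity. [cite: MochizukiAbsTopIII2015, Cor 5.10 (iv)(c) p. 148] -/
theorem sum_gammaOneApp_inl_snd (v : V₁) {ν₁ ν₂ : LogVertex (isArc₁ v)} (ε : LogEdgeTS (isArc₁ v) ν₁ ν₂)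
    (hε : ε.InCore) (y : (L₁.sum L₂).X) :
    ((sumIotaData I₁ I₂).gammaOneApp (.inl v) ε hε y).2 =
      𝟙 ((L₂.proj ⋙ L₂.monoAn ⋙ L₂.κAnMono.functor ⋙ L₂.κAnMono.inverse).obj y.2) := by
  simp only [IotaAnMono.gammaOneApp, iotaCore, sum_iotaPre_inl, sumIotaData, sumIotaAnMono_ι_inl]
  change L₂.κAnMono.inverse.map ((𝟭 L₂.X ⋙ L₂.proj ⋙ L₂.monoAn ⋙ L₂.κAnMono.functor).map (𝟙 y.2)) ≫ 𝟙 _ = 𝟙 _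
  erw [CategoryTheory.Functor.map_id, CategoryTheory.Functor.map_id, Category.comp_id]

/-- `γ¹` of the sum at `inr v`, components. [cite: MochizukiAbsTopIII2015, Cor 5.10 (iv)(c) p. 148] -/
theorem sum_gammaOneApp_inr_snd (v : V₂) {ν₁ ν₂ : LogVertex (isArc₂ v)} (ε : LogEdgeTS (isArc₂ v) ν₁ ν₂)
    (hε : ε.InCore) (y : (L₁.sum L₂).X) :
    ((sumIotaData I₁ I₂).gammaOneApp (.inr v) ε hε y).2 = I₂.gammaOneApp v ε hε y.2 := by
  simp only [IotaAnMono.gammaOneApp, iotaCore, sum_iotaPre_inr, sumIotaData, sumIotaAnMono_ι_inr]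
  rfl

/-- … first component = an identity. [cite: MochizukiAbsTopIII2015, Cor 5.10 (iv)(c) p. 148] -/
theorem sum_gammaOneApp_inr_fst (v : V₂) {ν₁ ν₂ : LogVertex (isArc₂ v)} (ε : LogEdgeTS (isArc₂ v) ν₁ ν₂)
    (hε : ε.InCore) (y : (L₁.sum L₂).X) :
    ((sumIotaData I₁ I₂).gammaOneApp (.inr v) ε hε y).1 =
      𝟙 ((L₁.proj ⋙ L₁.monoAn ⋙ L₁.κAnMono.functor ⋙ L₁.κAnMono.inverse).obj y.1) := by
  simp only [IotaAnMono.gammaOneApp, iotaCore, sum_iotaPre_inr, sumIotaData, sumIotaAnMono_ι_inr]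
  change L₁.κAnMono.inverse.map ((𝟭 L₁.X ⋙ L₁.proj ⋙ L₁.monoAn ⋙ L₁.κAnMono.functor).map (𝟙 y.1)) ≫ 𝟙 _ = 𝟙 _
  erw [CategoryTheory.Functor.map_id, CategoryTheory.Functor.map_id, Category.comp_id]

/-- ★ **The `η⊢`-square of Cor 5.10 (iv)(c) is inherited by the SUM**: if the squares commute for `(K₁, I₁)` over `V₁` and for
`(K₂, I₂)` over `V₂`, they commute for the sum over `V₁ ⊕ V₂` (at `inl v`: the first factor's square, and on the carried object
the trivial square `η ≫ 𝟙 = 𝟙 ≫ η`). [cite: MochizukiAbsTopIII2015, Cor 5.10 (iv)(c) p. 148] -/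
theorem etaNatural_sum (h₁ : K₁.EtaNatural I₁) (h₂ : K₂.EtaNatural I₂) :
    (sumMonoTelecoreCoherence K₁ K₂).EtaNatural (sumIotaData I₁ I₂) := by
  rintro (v | v) ν₁ ν₂ ε hε y
  · apply Prod.hom_ext
    · change ((K₁.eta v ν₁ hε.isCross_src).hom.app y.1 ≫ ((L₁.sum L₂).gammaZeroApp (.inl v) ε hε y).1) =
        ((sumIotaData I₁ I₂).gammaOneApp (.inl v) ε hε y).1 ≫ (K₁.eta v ν₂ hε.isCross_tgt).hom.app y.1
      rw [sum_gammaZeroApp_inl_fst, sum_gammaOneApp_inl_fst]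
      exact h₁ v ε hε y.1
    · change (L₂.carriedEta.hom.app y.2 ≫ ((L₁.sum L₂).gammaZeroApp (.inl v) ε hε y).2) =
        ((sumIotaData I₁ I₂).gammaOneApp (.inl v) ε hε y).2 ≫ L₂.carriedEta.hom.app y.2
      rw [sum_gammaZeroApp_inl_snd, sum_gammaOneApp_inl_snd]
      erw [Category.comp_id, Category.id_comp]
  · apply Prod.hom_ext
    · change (L₁.carriedEta.hom.app y.1 ≫ ((L₁.sum L₂).gammaZeroApp (.inr v) ε hε y).1) =
        ((sumIotaData I₁ I₂).gammaOneApp (.inr v) ε hε y).1 ≫ L₁.carriedEta.hom.app y.1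
      rw [sum_gammaZeroApp_inr_fst, sum_gammaOneApp_inr_fst]
      erw [Category.comp_id, Category.id_comp]
    · change ((K₂.eta v ν₁ hε.isCross_src).hom.app y.2 ≫ ((L₁.sum L₂).gammaZeroApp (.inr v) ε hε y).2) =
        ((sumIotaData I₁ I₂).gammaOneApp (.inr v) ε hε y).2 ≫ (K₂.eta v ν₂ hε.isCross_tgt).hom.app y.2
      rw [sum_gammaZeroApp_inr_snd, sum_gammaOneApp_inr_snd]
      exact h₂ v ε hε y.2

end EtaSquare

/-! ## §3. Genuine instances -/

section TwoPrime

variable (p ℓ : ℕ) [Fact p.Prime] [Fact ℓ.Prime] (V₁ V₂ : Type 1)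

/-- ★ **Nonarchimedean places of TWO residue characteristics in ONE setting**: the sum of abc-iut-f-101's genuine
open-augmentation settings at the primes `p` (places in `V₁`) and `ℓ` (places in `V₂`).
[cite: MochizukiAbsTopIII2015, Prop 5.8 (vii) p. 141] -/
abbrev twoPrimeOpen : LogFrobeniusSetting (V₁ ⊕ V₂) (Sum.elim (fun _ => false) (fun _ => false)) :=
  (genuineOpen p V₁).sum (genuineOpen ℓ V₂)

/-- `𝒳 = 𝒳^{open}_p × 𝒳^{open}_ℓ`. [cite: MochizukiAbsTopIII2015, Def 5.4 (i) p. 125] -/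
theorem twoPrimeOpen_X : (twoPrimeOpen p ℓ V₁ V₂).X = ((genuineOpen p V₁).X × (genuineOpen ℓ V₂).X) := rfl

/-- Its mono-analyticization homotopies (from f-101's at each prime). [cite: MochizukiAbsTopIII2015, Cor 5.10 p. 146] -/
def twoPrimeOpen_monoAnalyticizationHomotopies : (twoPrimeOpen p ℓ V₁ V₂).MonoAnalyticizationHomotopies :=
  sumMonoAnalyticizationHomotopies (monoAnalyticizationHomotopies_open p V₁) (monoAnalyticizationHomotopies_open ℓ V₂)

/-- ★ **The coherence add-on at two residue characteristics, HYPOTHESIS-FREE** (from abc-iut-f-101's `monoTelecoreCoherence_open`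
at `p` and at `ℓ`). [cite: MochizukiAbsTopIII2015, Cor 5.10 (iv)(c) p. 148] -/
def twoPrimeOpen_monoTelecoreCoherence :
    (twoPrimeOpen p ℓ V₁ V₂).MonoTelecoreCoherence (twoPrimeOpen_monoAnalyticizationHomotopies p ℓ V₁ V₂) :=
  sumMonoTelecoreCoherence (monoTelecoreCoherence_open p V₁) (monoTelecoreCoherence_open ℓ V₂)

/-- ★ **PINNED Cor 5.10 (iv)(b)(c) HOLDS at two residue characteristics** (`V₁ ⊕ V₂ ≠ ∅`).
[cite: MochizukiAbsTopIII2015, Cor 5.10 (iv)(b)(c) pp. 147–148] -/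
theorem twoPrimeOpen_cor510MonoTelecorePinned [Nonempty (V₁ ⊕ V₂)] :
    (twoPrimeOpen p ℓ V₁ V₂).Cor510MonoTelecorePinned :=
  (twoPrimeOpen_monoTelecoreCoherence p ℓ V₁ V₂).cor510MonoTelecorePinned

/-- Cor 5.10 (iv)(a) there. [cite: MochizukiAbsTopIII2015, Cor 5.10 (iv)(a) p. 147] -/
theorem twoPrimeOpen_cor510MonoCores [Nonempty (V₁ ⊕ V₂)] : (twoPrimeOpen p ℓ V₁ V₂).Cor510MonoCores :=
  cor510MonoCores_holds (twoPrimeOpen_monoAnalyticizationHomotopies p ℓ V₁ V₂)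

/-- The `ι^{An⊢⊞}`-data there (genuine perfection arrows at both primes). [cite: MochizukiAbsTopIII2015, Prop 5.8 (vii) p. 142] -/
def twoPrimeOpen_iotaData : (twoPrimeOpen_monoTelecoreCoherence p ℓ V₁ V₂).IotaData :=
  sumIotaData (nonarchGenuineMonoAnPfOpen_iotaAnMono p V₁ (fun _ => false))
    (nonarchGenuineMonoAnPfOpen_iotaAnMono ℓ V₂ (fun _ => false))

/-- ★ **The `η⊢`-square HOLDS at two residue characteristics, HYPOTHESIS-FREE** (abc-iut-L4-t3's `etaNatural_genuineOpen` at
`p` and at `ℓ`). [cite: MochizukiAbsTopIII2015, Cor 5.10 (iv)(c) p. 148] -/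
theorem twoPrimeOpen_etaNatural :
    (twoPrimeOpen_monoTelecoreCoherence p ℓ V₁ V₂).EtaNatural (twoPrimeOpen_iotaData p ℓ V₁ V₂) :=
  etaNatural_sum _ _ (etaNatural_genuineOpen p V₁) (etaNatural_genuineOpen ℓ V₂)

/-- **Summary at two residue characteristics**: ONE setting over `V₁ ⊕ V₂` (all places nonarchimedean, residue characteristic
`p` on `V₁`, `ℓ` on `V₂`) carrying the mono-analyticization homotopies, the coherence add-on, the `ι^{An⊢⊞}`-data with the
`η⊢`-square, and satisfying Cor 5.10 (iv)(a) and the pinned (iv)(b)(c) — zero hypotheses beyond `V₁ ⊕ V₂ ≠ ∅`.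
[cite: MochizukiAbsTopIII2015, Cor 5.10 (iv) pp. 147–148] -/
theorem exists_twoPrime_coherent [Nonempty (V₁ ⊕ V₂)] :
    ∃ (L : LogFrobeniusSetting (V₁ ⊕ V₂) (Sum.elim (fun _ => false) (fun _ => false)))
      (M : L.MonoAnalyticizationHomotopies) (K : L.MonoTelecoreCoherence M) (I : K.IotaData),
      L.X = ((genuineOpen p V₁).X × (genuineOpen ℓ V₂).X) ∧ K.EtaNatural I ∧ L.Cor510MonoCores ∧
        L.Cor510MonoTelecorePinned :=
  ⟨twoPrimeOpen p ℓ V₁ V₂, _, twoPrimeOpen_monoTelecoreCoherence p ℓ V₁ V₂, twoPrimeOpen_iotaData p ℓ V₁ V₂, rfl,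
    twoPrimeOpen_etaNatural p ℓ V₁ V₂, twoPrimeOpen_cor510MonoCores p ℓ V₁ V₂,
    twoPrimeOpen_cor510MonoTelecorePinned p ℓ V₁ V₂⟩

end TwoPrime

section TwoSided

variable (p : ℕ) [Fact p.Prime] (𝔄 : AutHolFieldFunctor.{0}) (V₁ V₂ : Type 1)

/-- ★ **GENUINE nonarchimedean AND archimedean rows in ONE setting with NO filler slot**: the sum of abc-iut-f-101's genuine
open-augmentation setting at `p` (places in `V₁`, all nonarchimedean) and this lineage's genuine archimedean setting over the
Aut-holomorphic field functor `𝔄` (places in `V₂`, all archimedean).  Successor of `genuineTwoSided` (gen 4), honest limit (P2)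
removed. [cite: MochizukiAbsTopIII2015, Prop 5.8 (vii) p. 141] -/
abbrev genuineTwoSidedSum : LogFrobeniusSetting (V₁ ⊕ V₂) (Sum.elim (fun _ => false) (fun _ => true)) :=
  (genuineOpen p V₁).sum (archGenuineMonoAnChart 𝔄 V₂ (fun _ => true))

/-- `𝒳 = 𝒳^{open}_p × 𝒞^hol_TF` (two-factor proxy of `Th•_T[Z]`, honest limit (P1)). [cite: MochizukiAbsTopIII2015, Def 5.4 (i) p. 125] -/
theorem genuineTwoSidedSum_X :
    (genuineTwoSidedSum p 𝔄 V₁ V₂).X = ((genuineOpen p V₁).X × (archGenuineMonoAnChart 𝔄 V₂ (fun _ => true)).X) := rfl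

/-- Its mono-analyticization homotopies (f-101's at `p`, this lineage's archimedean ones over `𝔄`).
[cite: MochizukiAbsTopIII2015, Cor 5.10 p. 146] -/
def genuineTwoSidedSum_monoAnalyticizationHomotopies : (genuineTwoSidedSum p 𝔄 V₁ V₂).MonoAnalyticizationHomotopies :=
  sumMonoAnalyticizationHomotopies (monoAnalyticizationHomotopies_open p V₁)
    (archGenuineMonoAnChart_monoAnalyticizationHomotopies 𝔄 V₂ (fun _ => true))

/-- **Cor 5.10 (iv)(a) HOLDS** at the two-sided sum (`V₁ ⊕ V₂ ≠ ∅`). [cite: MochizukiAbsTopIII2015, Cor 5.10 (iv)(a) p. 147] -/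
theorem genuineTwoSidedSum_cor510MonoCores [Nonempty (V₁ ⊕ V₂)] : (genuineTwoSidedSum p 𝔄 V₁ V₂).Cor510MonoCores :=
  cor510MonoCores_holds (genuineTwoSidedSum_monoAnalyticizationHomotopies p 𝔄 V₁ V₂)

/-- The `hψ` of the two-sided sum. [cite: MochizukiAbsTopIII2015, Definition 5.6 (iv) p. 136] -/
def genuineTwoSidedSum_ψOverIso :
    ∀ (w : V₁ ⊕ V₂) (j : {ν : LogVertex (Sum.elim (fun _ => false) (fun _ => true) w) // ν.IsCross}),
      (genuineTwoSidedSum p 𝔄 V₁ V₂).ψAnMono w j ⋙ (genuineTwoSidedSum p 𝔄 V₁ V₂).forgetMono w ⋙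
          (genuineTwoSidedSum p 𝔄 V₁ V₂).toEmono w ≅
        (genuineTwoSidedSum p 𝔄 V₁ V₂).κAnMono.inverse :=
  sumψOverIso (nonarchGenuineMonoAnPfOpen_ψOverIso p V₁ (fun _ => false)) (archGenuineMonoAnChart_ψOverIso 𝔄 V₂ (fun _ => true))

/-- ★ **abc-iut-L4-t3's `ι^{An⊢⊞}` add-on INHABITED at the two-sided sum**: f-101's genuine perfection arrows at the places of
`V₁`, the archimedean `k∼ ↠ k×` arrows at the places of `V₂` — each place its own genuine datum.
[cite: MochizukiAbsTopIII2015, Prop 5.8 (vii) p. 142] -/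
def genuineTwoSidedSum_iotaAnMono :
    (genuineTwoSidedSum p 𝔄 V₁ V₂).IotaAnMono (genuineTwoSidedSum_ψOverIso p 𝔄 V₁ V₂) :=
  sumIotaAnMono (nonarchGenuineMonoAnPfOpen_iotaAnMono p V₁ (fun _ => false))
    (archGenuineMonoAnChart_iotaAnMono 𝔄 V₂ (fun _ => true))

/-- **The coherence add-on of the two-sided sum the moment an ARCHIMEDEAN coherence datum `K_arc` exists** (binder, honestly:
the archimedean `η⊢` content is in the tree — abc-iut-w5-d038's `HolTFPair.etaTilde` / `etaTimes` — but its packaging as a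
`MonoTelecoreCoherence` of `archGenuineMonoAnChart` awaits the L4-lead's interface ruling m151 (3)); the nonarchimedean half is
abc-iut-f-101's `monoTelecoreCoherence_open`, hypothesis-free. [cite: MochizukiAbsTopIII2015, Cor 5.10 (iv)(c) p. 148] -/
def genuineTwoSidedSum_monoTelecoreCoherence_of
    (K_arc : (archGenuineMonoAnChart 𝔄 V₂ (fun _ => true)).MonoTelecoreCoherence
      (archGenuineMonoAnChart_monoAnalyticizationHomotopies 𝔄 V₂ (fun _ => true))) :
    (genuineTwoSidedSum p 𝔄 V₁ V₂).MonoTelecoreCoherence (genuineTwoSidedSum_monoAnalyticizationHomotopies p 𝔄 V₁ V₂) :=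
  sumMonoTelecoreCoherence (monoTelecoreCoherence_open p V₁) K_arc

/-- … and then the PINNED Cor 5.10 (iv)(b)(c) at the two-sided sum. [cite: MochizukiAbsTopIII2015, Cor 5.10 (iv)(b)(c) pp. 147–148] -/
theorem genuineTwoSidedSum_cor510MonoTelecorePinned_of [Nonempty (V₁ ⊕ V₂)]
    (K_arc : (archGenuineMonoAnChart 𝔄 V₂ (fun _ => true)).MonoTelecoreCoherence
      (archGenuineMonoAnChart_monoAnalyticizationHomotopies 𝔄 V₂ (fun _ => true))) :
    (genuineTwoSidedSum p 𝔄 V₁ V₂).Cor510MonoTelecorePinned :=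
  (genuineTwoSidedSum_monoTelecoreCoherence_of p 𝔄 V₁ V₂ K_arc).cor510MonoTelecorePinned

/-- **Summary at the two-sided sum, today**: genuine rows at BOTH place types in one term, Cor 5.10 (iv)(a), and the `ι^{An⊢⊞}`
add-on inhabited — zero hypotheses beyond `V₁ ⊕ V₂ ≠ ∅`. [cite: MochizukiAbsTopIII2015, Prop 5.8 (vii) p. 141] -/
theorem exists_genuineTwoSidedSum [Nonempty (V₁ ⊕ V₂)] :
    ∃ (L : LogFrobeniusSetting (V₁ ⊕ V₂) (Sum.elim (fun _ => false) (fun _ => true)))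
      (hψ : ∀ (w : V₁ ⊕ V₂) (j : {ν : LogVertex (Sum.elim (fun _ => false) (fun _ => true) w) // ν.IsCross}),
        L.ψAnMono w j ⋙ L.forgetMono w ⋙ L.toEmono w ≅ L.κAnMono.inverse),
      L.X = ((genuineOpen p V₁).X × (archGenuineMonoAnChart 𝔄 V₂ (fun _ => true)).X) ∧
        Nonempty L.MonoAnalyticizationHomotopies ∧ Nonempty (L.IotaAnMono hψ) ∧ L.Cor510MonoCores :=
  ⟨genuineTwoSidedSum p 𝔄 V₁ V₂, genuineTwoSidedSum_ψOverIso p 𝔄 V₁ V₂, rfl,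
    ⟨genuineTwoSidedSum_monoAnalyticizationHomotopies p 𝔄 V₁ V₂⟩, ⟨genuineTwoSidedSum_iotaAnMono p 𝔄 V₁ V₂⟩,
    genuineTwoSidedSum_cor510MonoCores p 𝔄 V₁ V₂⟩

end TwoSided

end LogFrobeniusSetting

end Literature.AnabelianGeometry.AbsoluteAnabelian

end
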